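import Mathlib
import HarnessLib
import Summits.ResolutionOfSingularities.ResolutionOfSingularities.Theorems.HomologicalConductorSurfaceTerminationGenusNonincreasing
import Summits.ResolutionOfSingularities.ResolutionOfSingularities.Theorems.HomologicalConductorSurfaceTerminationGenusTwoRegularConsumers
import Literature.AlgebraicGeometry.CossartPiltant200819.Thm11ProjectiveIntegral2019

/-!
# Kill test `SurfaceTermination` (stmt-ResolutionOfSingularities-16488), LINE genus-descent: the geometric genus is
# NON-INCREASING along the canonical tower — modulo Cossart–Jannsen–Saito 2020 ONLY (no Lipman (1.2), no Görtz–Wedhorn 24.44)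

Route `ResolutionOfSingularities/HomologicalConductor` (cell decomp-res, hand leafhand-res-homologicalconduct-3 g1).
OURS: AI-written, weaker than expert review; nothing here is a statement of the manuscript under review (Hironaka 2017).
SUPPORT level, counted 0.  Def-free, no new named facts.

The theorem of record `GenusDescent.hasGeometricGenusLE_tower_succ_succ` (`…GenusNonincreasing`, U2e assembly) —
`p_g(T_(m+2)) ≤ p_g(T_(m+1))` along the canonical normalised `ca`-tower of a surface datum — carries THREE named facts: CJS 2020
Thm 1.2 (resolutions), Lipman (1.2) (domination step) and Görtz–Wedhorn 24.44 (Leray gluing).  Two of them are idle AT THE USE SITE: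
the middle model there is the blow-up `Bl_ca(Spec T_(m+1)) = affineBlowup.π _`, which is PROJECTIVE over `T_(m+1)`
(`Resolution.affineBlowup.isProjectiveOverRing`, Liu Prop. 8.1.12 (b)), so the gluing step is the fact-free projective form; and the
domination step is between two REGULAR models, where Lipman (1.2) is the tree theorem of the F-79 «2-reg» cell
(`GenusDescent.TwoRegular.hasGeometricGenusLE_of_chart_of_isProjectiveOverRing`, «print-free end to end»).  Hence:

* `hasGeometricGenusLE_of_chart'_of_isProjectiveOverRing` — the supplier form `hasGeometricGenusLE_of_chart'` (`…GenusCover`) with the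
  binders `h12`, `hGW` REMOVED and `hproj : IsProjectiveOverRing (Over.mk g_B)` added (body verbatim, re-pointed to the 2-reg sibling);
* **`hasGeometricGenusLE_tower_succ_succ_of_cjs (hCJS)`** — `p_g(T_(m+2)) ≤ p_g(T_(m+1))` modulo `CossartJannsenSaito2020General` ONLY
  (body of the theorem of record verbatim, the one chart call re-pointed);
* **`pgNonincreasing_of_cjs (hCJS)`** — the registered r7/r8 stub text `stub_pgNonincreasing` with its six-fact bundle replaced by the ONE
  print CJS 2020 Thm 1.2.

Census consequence: in the r8 genus-descent line of the kill test, Görtz–Wedhorn 24.44 and Lipman (1.2) are idle for genus monotonicity;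
CJS 2020 (existence of resolutions of excellent surfaces) remains.  No crux, kill test or summit statement is proved; resolution of
singularities in positive characteristic is NOT proved.
-/

-- single-problem summit: the doubled namespace component `ResolutionOfSingularities` is forced
set_option linter.dupNamespace false

noncomputable section

open CategoryTheory CategoryTheory.Limits AlgebraicGeometry TopologicalSpace IsLocalRing
open Literature.AlgebraicGeometry.Resolution Literature.AlgebraicGeometry.Morphisms
open Summit.ResolutionOfSingularities.ResolutionOfSingularities.Theorems
open Summit.ResolutionOfSingularities.ResolutionOfSingularities.Theorems.NoZeno.Birth
open Summit.ResolutionOfSingularities.ResolutionOfSingularities.Theorems.NoZeno.SandwichCluster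
open Summit.ResolutionOfSingularities.ResolutionOfSingularities.Theorems.SurfaceTermination.ChartResolution

namespace Summit.ResolutionOfSingularities.ResolutionOfSingularities.Theorems.SurfaceTermination.GenusDescent

variable {k K : Type} [Field k] [Field K] [Algebra k K]

/-- **`hasGeometricGenusLE_of_chart'` over a PROJECTIVE middle model, print-free**: the supplier form of the chart lemma with
`h12`, `hGW` removed and `hproj` added; the good cover is produced by `exists_goodCover_isAffineOpen_mixed` exactly as in
`…GenusCover`, and the core is the 2-reg sibling `TwoRegular.hasGeometricGenusLE_of_chart_of_isProjectiveOverRing`.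
[cite: GortzWedhorn2023, Cor. 24.44 (projective case)] [cite: Piltant2013, proof of Prop. 5.1, Step 3] -/
theorem hasGeometricGenusLE_of_chart'_of_isProjectiveOverRing
    {T : Type} [CommRing T] [IsDomain T] [IsNoetherianRing T] [IsLocalRing T]
    (hdimT : ringKrullDim T ≤ 2)
    {X : Scheme.{0}} (ξ : X ⟶ Spec (.of T)) (hξ : IsResolution ξ) (g : ℕ)
    (hbound : ∀ (ι : Type) [Finite ι] (U : ι → X.Opens), (∀ i, IsAffineOpen (U i)) →
      ⨆ i, U i = ⊤ → Module.length T (CechH1 ξ U) ≤ (g : ℕ∞))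
    {Z : Scheme.{0}} [IsIntegral Z] (τ : Z ⟶ X) [IsProper τ] (hτ : IsBirational τ)
    (hZreg : Scheme.IsRegular Z) (hdimZ : topologicalKrullDim Z ≤ 2)
    {B : Scheme.{0}} [IsIntegral B] (gB : B ⟶ Spec (.of T)) [IsProper gB] (hgB : IsBirational gB)
    (hproj : Literature.AlgebraicGeometry.Crystalline.IsProjectiveOverRing
      (CategoryTheory.Over.mk gB : Literature.AlgebraicGeometry.Motives.SchemeOver T))
    (hdimB : topologicalKrullDim B ≤ 2)
    (σB : Z ⟶ B) [IsProper σB] (hσBbir : IsBirational σB) (hσB : σB ≫ gB = τ ≫ ξ)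
    (W₀ : B.Opens) (hW₀ : IsAffineOpen W₀)
    {N : Type} [CommRing N] [IsDomain N] [IsNoetherianRing N] [IsIntegrallyClosed N] [Algebra T N]
    (ν : Spec (.of N) ⟶ B) (hνC : Set.range ν.base ⊆ (W₀ : Set B))
    (σ : ((σB ⁻¹ᵁ W₀ : Z.Opens) : Scheme.{0}) ⟶ Spec (.of N)) (hσ : IsResolution σ)
    (htri : σ ≫ ν = (σB ⁻¹ᵁ W₀).ι ≫ σB)
    (hσT : (σB ⁻¹ᵁ W₀).ι ≫ (τ ≫ ξ) = σ ≫ Spec.map (CommRingCat.ofHom (algebraMap T N)))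
    (T' : Type) [CommRing T'] [IsDomain T'] [Algebra N T'] (M : Submonoid N) [IsLocalization M T'] :
    HasGeometricGenusLE T' g := by
  haveI : IsProper σ := hσ.isProper
  obtain ⟨α, _, W, a₀, hWa₀, hWaff, hWcov, hmixed⟩ := exists_goodCover_isAffineOpen_mixed σB W₀ ν σ
    gB hW₀ hdimB hdimZ hσBbir hνC hσ.isBirational htri
  subst hWa₀
  exact TwoRegular.hasGeometricGenusLE_of_chart_of_isProjectiveOverRing hdimT ξ hξ g hbound τ hτ hZreg gB hgB hproj σB hσB
    W hWaff hWcov a₀ (fun b hb => by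
      intro κ G hG
      exact cechZ1_le_cechB1_of_isAffineOpen_of_iSup_eq (τ ≫ ξ) (hmixed b hb) G hG)
    σ hσ hσT T' M

set_option maxHeartbeats 800000 in
-- the chart algebra `(T[It])_{(xt)}` is a homogeneous localisation: instance unification on it is slow
-- (same phenomenon as in `…ChartResolution`), hence the budget
/-- **`p_g(T_(m+2)) ≤ p_g(T_(m+1))` along the canonical tower, modulo CJS 2020 ONLY** (twin of
`hasGeometricGenusLE_tower_succ_succ`; the chart step runs through `hasGeometricGenusLE_of_chart'_of_isProjectiveOverRing`
with the middle model `Bl_ca(Spec T_(m+1))` projective by `Resolution.affineBlowup.isProjectiveOverRing`; no Lipman (1.2), no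
Görtz–Wedhorn 24.44). [cite: CossartJannsenSaito2020, Thm. 1.2] [cite: Artin1986, Prop. (3.2)(i)] [cite: Liu2002, Prop. 8.1.12 (b)] -/
theorem hasGeometricGenusLE_tower_succ_succ_of_cjs (hCJS : CossartJannsenSaito2020General.{0})
    (O : ValuationSubring K) (A : Subalgebra k K) (hk : ∀ c : k, algebraMap k K c ∈ O) (hA : A.FG)
    (hfr : IsFractionRing ↥A K) (hAO : A.toSubring ≤ O.toSubring) (htr : Algebra.trdeg k K = 2)
    (m g : ℕ) (hg : HasGeometricGenusLE ↥(tower O A (m + 1)) g) :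
    HasGeometricGenusLE ↥(tower O A (m + 1 + 1)) g := by
  classical
  haveI := hfr
  -- a regular next stage has genus `0`
  by_cases hreg' : IsRegularLocalRing ↥(tower O A (m + 1 + 1))
  · haveI := hreg'
    exact hasGeometricGenusLE_mono (Nat.zero_le g)
      ((hasGeometricGenusLE_zero_iff _).mpr (hasRationalSingularity_of_isRegularLocalRing _))
  -- hence the stage `T = T_(m+1)` is singular too (a regular stage is terminal)
  have hsing : ¬ IsRegularLocalRing ↥(tower O A (m + 1)) := by
    intro hreg
    apply hreg'
    rw [tower_succ_eq_self_of_isRegularLocalRing O A hk hfr hAO (m + 1) hreg]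
    exact hreg
  -- the stage package
  obtain ⟨hnoeth, hic, hfrT, hloc, hdimT, hET⟩ :=
    RationalDescent.stage_package_of_trdeg O A hk hA hfr hAO htr m hsing
  haveI := hnoeth; haveI := hic; haveI := hfrT; haveI := hloc; haveI := hET
  have hTexc : IsExcellentRing ↥(tower O A (m + 1)) := (isExcellentRing_of_field k).of_essFiniteType hET
  have hTO : (tower O A (m + 1)).toSubring ≤ O.toSubring :=
    (tn_tower_invariant O A hk hA hfr hAO (m + 1)).2.1
  -- the given resolution with the genus bound
  obtain ⟨X, ξ, hξ, hbound⟩ := hg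
  haveI : IsProper ξ := hξ.isProper
  -- an admissible denominator `x ∈ ca T`, `I = ca(↥T) ≠ 0`
  obtain ⟨x₀, hx₀, hx₀0, hadm⟩ := Thread.exists_admissible_tower O A hk hA hfr hAO (m + 1)
  let x : ↥(tower O A (m + 1)) := ⟨x₀, ca_subset _ hx₀⟩
  have hxI : x ∈ Literature.RingTheory.CohomologyAnnihilator.cohomologyAnnihilator ↥(tower O A (m + 1)) :=
    (tn_coe_mem_ca_iff _ x).mp hx₀
  have hx0 : (x : K) ≠ 0 := hx₀0
  have hI : Literature.RingTheory.CohomologyAnnihilator.cohomologyAnnihilator ↥(tower O A (m + 1)) ≠ ⊥ :=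
    fun h => hx₀0 (by
      have := hxI; rw [h, Ideal.mem_bot] at this; rw [show x₀ = (x : K) from rfl, this]; rfl)
  -- (K1) the dominating resolution and its lift to the blowing up
  obtain ⟨Z, hZ, ρ, τX, hρ, hτξ, hτp, hτb, hCart⟩ :=
    exists_isResolution_dominating_of_cjsGeneral hCJS hTexc hdimT.le _ hI ξ hξ
  haveI := hZ
  haveI := hτp
  haveI : IsProper ρ := hρ.isProper
  let σB := (affineBlowup.isBlowup _).lift ρ hCart
  have hσB : σB ≫ affineBlowup.π _ = ρ := IsBlowup.lift_comp _ _ _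
  haveI : IsProper σB := isProper_of_comp (tower O A (m + 1)) ρ σB hσB
  haveI hBint : IsIntegral (affineBlowup
      (Literature.RingTheory.CohomologyAnnihilator.cohomologyAnnihilator ↥(tower O A (m + 1)))) :=
    affineBlowup.isIntegral hI
  have hπbir : IsBirational (affineBlowup.π
      (Literature.RingTheory.CohomologyAnnihilator.cohomologyAnnihilator ↥(tower O A (m + 1)))) :=
    affineBlowup.isBirational hI
  have hσBbir : IsBirational σB :=
    isBirational_of_comp' hπbir (by rw [hσB]; exact hρ.isBirational)
  -- dimensions
  have hdimSpec : topologicalKrullDim (Spec (.of ↥(tower O A (m + 1)))) ≤ 2 :=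
    (le_of_eq (PrimeSpectrum.topologicalKrullDim_eq_ringKrullDim (R := ↥(tower O A (m + 1))))).trans
      hdimT.le
  have hdimZ : topologicalKrullDim Z ≤ 2 := by
    rw [hρ.isBirational.topologicalKrullDim_eq_of_isProper]; exact hdimSpec
  have hdimB : topologicalKrullDim (affineBlowup
      (Literature.RingTheory.CohomologyAnnihilator.cohomologyAnnihilator ↥(tower O A (m + 1)))) ≤ 2 := by
    rw [hπbir.topologicalKrullDim_eq_of_isProper]; exact hdimSpec
  -- (K2) the chart resolution with its values
  obtain ⟨e, he⟩ := exists_functionField_ringEquiv (tower O A (m + 1)) ρ hρ.isBirational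
  obtain ⟨hne, σ, hσval, hσc, hσres⟩ :=
    exists_isResolution_chartMorphism (tower O A (m + 1)) ρ e he σB hσB hxI hρ hx0
  -- the normalised chart ring `N = nrm (k[T ∪ I·x⁻¹])` (written out literally below)
  have hTN : tower O A (m + 1) ≤ (nrm (Algebra.adjoin k (((tower O A (m + 1)) : Set K) ∪
      {y : K | ∃ c : ↥(tower O A (m + 1)),
        c ∈ Literature.RingTheory.CohomologyAnnihilator.cohomologyAnnihilator ↥(tower O A (m + 1)) ∧
          y = (c : K) * (x : K)⁻¹}))) := le_nrm_adjoin (tower O A (m + 1))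
  haveI hCfrac : IsFractionRing ↥(Algebra.adjoin k (((tower O A (m + 1)) : Set K) ∪
      {y : K | ∃ c : ↥(tower O A (m + 1)),
        c ∈ Literature.RingTheory.CohomologyAnnihilator.cohomologyAnnihilator ↥(tower O A (m + 1)) ∧
          y = (c : K) * (x : K)⁻¹})) K :=
    isFractionRing_subalgebra_of_le (tower O A (m + 1)) _ fun y hy => Algebra.subset_adjoin (Or.inl hy)
  have hCeft : Algebra.EssFiniteType k ↥(Algebra.adjoin k (((tower O A (m + 1)) : Set K) ∪
      {y : K | ∃ c : ↥(tower O A (m + 1)),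
        c ∈ Literature.RingTheory.CohomologyAnnihilator.cohomologyAnnihilator ↥(tower O A (m + 1)) ∧
          y = (c : K) * (x : K)⁻¹})) := by
    have h := HomologicalConductor.PersistenceAffineChartEssFiniteType.stub_affineChartEssFiniteType k K
      (tower O A (m + 1)) (x : K) hET
    rw [← HomologicalConductor.PersistenceRadical.ca_eq_image, setOf_ca_mul_inv_eq] at h
    exact h
  have hNeft : Algebra.EssFiniteType k ↥(nrm (Algebra.adjoin k (((tower O A (m + 1)) : Set K) ∪
      {y : K | ∃ c : ↥(tower O A (m + 1)),
        c ∈ Literature.RingTheory.CohomologyAnnihilator.cohomologyAnnihilator ↥(tower O A (m + 1)) ∧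
          y = (c : K) * (x : K)⁻¹}))) :=
    SyzygyFlattening.stub_essFiniteType_nrm k K _ hCfrac hCeft
  haveI hNnoeth : IsNoetherianRing ↥(nrm (Algebra.adjoin k (((tower O A (m + 1)) : Set K) ∪
      {y : K | ∃ c : ↥(tower O A (m + 1)),
        c ∈ Literature.RingTheory.CohomologyAnnihilator.cohomologyAnnihilator ↥(tower O A (m + 1)) ∧
          y = (c : K) * (x : K)⁻¹}))) :=
    Algebra.EssFiniteType.isNoetherianRing k _
  haveI hNic : IsIntegrallyClosed ↥(nrm (Algebra.adjoin k (((tower O A (m + 1)) : Set K) ∪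
      {y : K | ∃ c : ↥(tower O A (m + 1)),
        c ∈ Literature.RingTheory.CohomologyAnnihilator.cohomologyAnnihilator ↥(tower O A (m + 1)) ∧
          y = (c : K) * (x : K)⁻¹}))) :=
    SyzygyFlattening.isIntegrallyClosed_nrm _
  -- the chart morphism `τ`, the value map `ψ`, and `ν = Spec ψ ≫ chartι`
  obtain ⟨τ, hτ, -⟩ := exists_chartHom (tower O A (m + 1)) ρ σB hσB hxI
  have hη := genericPoint_mem_image_top (σB ⁻¹ᵁ (affineBlowup.chartOpen x hxI).1) hne
  have hIN : ∀ c : ↥(tower O A (m + 1)),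
      c ∈ Literature.RingTheory.CohomologyAnnihilator.cohomologyAnnihilator ↥(tower O A (m + 1)) →
        (c : K) * (x : K)⁻¹ ∈ (nrm (Algebra.adjoin k (((tower O A (m + 1)) : Set K) ∪
      {y : K | ∃ c : ↥(tower O A (m + 1)),
        c ∈ Literature.RingTheory.CohomologyAnnihilator.cohomologyAnnihilator ↥(tower O A (m + 1)) ∧
          y = (c : K) * (x : K)⁻¹}))) := fun c hc =>
    SyzygyFlattening.self_le_nrm _ (Algebra.subset_adjoin (Or.inr ⟨c, hc, rfl⟩))
  obtain ⟨ψ, hψ⟩ := exists_chartRingHom (tower O A (m + 1)) ρ e he σB hσB hxI τ hτ hη hx0 _ hTN hIN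
  have hνC : Set.range (Spec.map ψ ≫ affineBlowup.chartι x hxI).base ⊆
      ((affineBlowup.chartOpen x hxI).1 : Set _) := by
    rintro _ ⟨n, rfl⟩
    have h1 : (Spec.map ψ ≫ affineBlowup.chartι x hxI).base n ∈
        Set.range (affineBlowup.chartι (I := _) x hxI) := by
      rw [Scheme.Hom.comp_base, TopCat.coe_comp, Function.comp_apply]
      exact ⟨_, rfl⟩
    rw [range_chartι_eq (tower O A (m + 1)) hxI, Scheme.Opens.range_ι] at h1
    exact h1
  have htri : σ ≫ (Spec.map ψ ≫ affineBlowup.chartι x hxI) =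
      (σB ⁻¹ᵁ (affineBlowup.chartOpen x hxI).1).ι ≫ σB :=
    (ι_comp_eq_comp_specMap_chartι e σB hxI τ hτ hη _ ψ hψ σ hσval).symm
  -- the `T`-structure of the chart
  letI algTN : Algebra ↥(tower O A (m + 1)) ↥(nrm (Algebra.adjoin k (((tower O A (m + 1)) : Set K) ∪
      {y : K | ∃ c : ↥(tower O A (m + 1)),
        c ∈ Literature.RingTheory.CohomologyAnnihilator.cohomologyAnnihilator ↥(tower O A (m + 1)) ∧
          y = (c : K) * (x : K)⁻¹}))) := (Subalgebra.inclusion hTN).toRingHom.toAlgebra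
  have hσT : (σB ⁻¹ᵁ (affineBlowup.chartOpen x hxI).1).ι ≫ (τX ≫ ξ) =
      σ ≫ Spec.map (CommRingCat.ofHom (algebraMap ↥(tower O A (m + 1)) ↥(nrm (Algebra.adjoin k (((tower O A (m + 1)) : Set K) ∪
      {y : K | ∃ c : ↥(tower O A (m + 1)),
        c ∈ Literature.RingTheory.CohomologyAnnihilator.cohomologyAnnihilator ↥(tower O A (m + 1)) ∧
          y = (c : K) * (x : K)⁻¹}))))) := by
    rw [hτξ]; exact hσc
  have hσBρ : σB ≫ affineBlowup.π _ = τX ≫ ξ := by rw [hσB, hτξ]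
  -- the next stage is the localisation of `N` at the centre
  have hsucc := tower_succ_eq_loc_nrm_adjoin O A (m + 1) hTO x hx₀ hx0 hadm
  have hNT : (nrm (Algebra.adjoin k (((tower O A (m + 1)) : Set K) ∪
      {y : K | ∃ c : ↥(tower O A (m + 1)),
        c ∈ Literature.RingTheory.CohomologyAnnihilator.cohomologyAnnihilator ↥(tower O A (m + 1)) ∧
          y = (c : K) * (x : K)⁻¹}))) ≤ tower O A (m + 1 + 1) := by
    rw [hsucc]; exact SyzygyFlattening.self_le_locAt O _
  have hNO : (nrm (Algebra.adjoin k (((tower O A (m + 1)) : Set K) ∪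
      {y : K | ∃ c : ↥(tower O A (m + 1)),
        c ∈ Literature.RingTheory.CohomologyAnnihilator.cohomologyAnnihilator ↥(tower O A (m + 1)) ∧
          y = (c : K) * (x : K)⁻¹}))).toSubring ≤ O.toSubring :=
    fun y hy => (tn_tower_invariant O A hk hA hfr hAO (m + 1 + 1)).2.1 (hNT hy)
  -- conclude for any `T'` equal to `loc O N` (so that the stage itself can be substituted)
  have key : ∀ (T' : Subalgebra k K) (hT' : T' = SyzygyFlattening.locAt O (nrm (Algebra.adjoin k (((tower O A (m + 1)) : Set K) ∪
      {y : K | ∃ c : ↥(tower O A (m + 1)),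
        c ∈ Literature.RingTheory.CohomologyAnnihilator.cohomologyAnnihilator ↥(tower O A (m + 1)) ∧
          y = (c : K) * (x : K)⁻¹})))),
      HasGeometricGenusLE ↥T' g := by
    intro T' hT'
    subst hT'
    letI algNT : Algebra ↥(nrm (Algebra.adjoin k (((tower O A (m + 1)) : Set K) ∪
      {y : K | ∃ c : ↥(tower O A (m + 1)),
        c ∈ Literature.RingTheory.CohomologyAnnihilator.cohomologyAnnihilator ↥(tower O A (m + 1)) ∧
          y = (c : K) * (x : K)⁻¹}))) ↥(SyzygyFlattening.locAt O (nrm (Algebra.adjoin k (((tower O A (m + 1)) : Set K) ∪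
      {y : K | ∃ c : ↥(tower O A (m + 1)),
        c ∈ Literature.RingTheory.CohomologyAnnihilator.cohomologyAnnihilator ↥(tower O A (m + 1)) ∧
          y = (c : K) * (x : K)⁻¹})))) :=
      (Subalgebra.inclusion (SyzygyFlattening.self_le_locAt O (nrm (Algebra.adjoin k (((tower O A (m + 1)) : Set K) ∪
      {y : K | ∃ c : ↥(tower O A (m + 1)),
        c ∈ Literature.RingTheory.CohomologyAnnihilator.cohomologyAnnihilator ↥(tower O A (m + 1)) ∧
          y = (c : K) * (x : K)⁻¹}))))).toRingHom.toAlgebra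
    haveI hL := SyzygyFlattening.isLocalization_locAt O (nrm (Algebra.adjoin k (((tower O A (m + 1)) : Set K) ∪
      {y : K | ∃ c : ↥(tower O A (m + 1)),
        c ∈ Literature.RingTheory.CohomologyAnnihilator.cohomologyAnnihilator ↥(tower O A (m + 1)) ∧
          y = (c : K) * (x : K)⁻¹}))) hNO
    exact hasGeometricGenusLE_of_chart'_of_isProjectiveOverRing hdimT.le ξ hξ g hbound τX hτb hρ.isRegular hdimZ
      (affineBlowup.π _) hπbir (Literature.AlgebraicGeometry.Resolution.affineBlowup.isProjectiveOverRing _) hdimB σB hσBbir hσBρ (affineBlowup.chartOpen x hxI).1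
      (affineBlowup.chartOpen x hxI).2 (Spec.map ψ ≫ affineBlowup.chartι x hxI) hνC σ hσres htri hσT
      ↥(SyzygyFlattening.locAt O (nrm (Algebra.adjoin k (((tower O A (m + 1)) : Set K) ∪
      {y : K | ∃ c : ↥(tower O A (m + 1)),
        c ∈ Literature.RingTheory.CohomologyAnnihilator.cohomologyAnnihilator ↥(tower O A (m + 1)) ∧
          y = (c : K) * (x : K)⁻¹}))))
      ((IsUnit.submonoid ↥(SyzygyFlattening.locAt O (nrm (Algebra.adjoin k (((tower O A (m + 1)) : Set K) ∪
      {y : K | ∃ c : ↥(tower O A (m + 1)),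
        c ∈ Literature.RingTheory.CohomologyAnnihilator.cohomologyAnnihilator ↥(tower O A (m + 1)) ∧
          y = (c : K) * (x : K)⁻¹}))))).comap
        (Subalgebra.inclusion (SyzygyFlattening.self_le_locAt O (nrm (Algebra.adjoin k (((tower O A (m + 1)) : Set K) ∪
      {y : K | ∃ c : ↥(tower O A (m + 1)),
        c ∈ Literature.RingTheory.CohomologyAnnihilator.cohomologyAnnihilator ↥(tower O A (m + 1)) ∧
          y = (c : K) * (x : K)⁻¹}))))))
  exact key (tower O A (m + 1 + 1)) hsucc

/-- **The registered stub text `stub_pgNonincreasing` modulo ONE print** (CJS 2020 Thm 1.2): along a prime divisor (the three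
prime-divisor hypotheses are inert, as in the theorem of record) the geometric genus of the stages does not increase,
`p_g(T_(m+2)) ≤ p_g(T_(m+1))`.  Twin of `stub_pgNonincreasing` (p-landed, six-fact bundle) over `hasGeometricGenusLE_tower_succ_succ_of_cjs`.
[cite: CossartJannsenSaito2020, Thm. 1.2] [cite: Artin1986, Prop. (3.2)(i)] -/
theorem pgNonincreasing_of_cjs
    (hCJS : Literature.AlgebraicGeometry.Resolution.CossartJannsenSaito2020General.{0}) :
    ∀ p : ℕ, p.Prime → ∀ (k K : Type) [Field k] [CharP k p] [Field K] [Algebra k K]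
    (O : ValuationSubring K) (A : Subalgebra k K) (hk : ∀ c : k, algebraMap k K c ∈ O), A.FG →
    IsFractionRing ↥A K → A.toSubring ≤ O.toSubring → ringKrullDim ↥A = 2 →
    O ≠ ⊤ → IsDiscreteValuationRing ↥O → residueTrdeg k O hk + 1 = Algebra.trdeg k K →
    ∀ g m : ℕ, HasGeometricGenusLE ↥(tower O A (m + 1)) g →
      HasGeometricGenusLE ↥(tower O A (m + 1 + 1)) g := by
  intro p _ k K _ _ _ _ O A hk hA hfr hAO hdimA _ _ _ g m hg
  haveI := hfr
  exact hasGeometricGenusLE_tower_succ_succ_of_cjs hCJS O A hk hA hfr hAO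
    (SurfaceTermination.Descent.trdeg_eq_two_of_ringKrullDim A hA hfr hdimA) m g hg

end Summit.ResolutionOfSingularities.ResolutionOfSingularities.Theorems.SurfaceTermination.GenusDescent

end
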